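import Summits.QuantumFields.YangMills.Theorems.UnitScaleTiltProp7BlendedGauge
import HarnessLib

/-!
# Route `UnitScaleTilt`, crux K1 child «MinimiserStabilityRegPr» (stmt-QuantumFields-19200), registered stub `stub_prop7From14` (skeleton birth_v7
# cc37a178…; leaf V3 «Prop 7 from a background (14)») — THE BLEND REDUCTION: ANY FAMILY OF CORNER GAUGES, NORMALISED AT ITS OWN CENTRE, BLENDS TO AN
# ELEMENT OF PRINT'S GROUP (4) WHOSE BOND VARIABLES OBEY THE POINTWISE BOUND `‖(W^g)_bU₀,b⁻¹ − 1‖ ≤ 1600·L^{−(K−n)}·D(b) + 4096·ρ(b)`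

Cell `ym3-torus` ∕ fleet seat `ym-ust-19200-p1` (gen 9; HUMAN RULING D-0037, YM ladder rung R3).  WHY.  `Prop7BlendedGauge.exists_blendedGauge_T3`
blends gen 7's COMB elements and gets the `k`-uniform SUP bound `551088(ε₀ + e₀)L^{−(K−n)}`; but the comb blend is NOT `ℓ²`-good (CARD-19200-V3-g9 §6: a
closed alternating flux sheet in a comb plane gives it the Poincaré constant `L^{3k}`, not `L^{2k}`), and the (4)-internal `ℓ²` route to clause 1 of
[Balaban1985Variational] Prop. 7 needs ONE representative that is both sup- and `ℓ²`-good.  The blend machinery itself (`Prop7GeodesicInterp`,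
`Prop7GeodesicBlend`, `Prop7BlendBond`, `Prop7BlendCells`) never looks inside the corner elements.  THIS FILE separates the two: it takes an ARBITRARY
family `vE x y ∈ SU(2)` (the «corner gauge of the centre `y` evaluated at the site `x`», e.g. local Coulomb gauges) with `vE y y = 1`, together with
POINTWISE data — on the cell of `z`, the eight corner gauges are pairwise `D(z,μ)`-close at `z` and at `z + e_μ`, and each transports `W_b` to within
`ρ(z,μ)` of `U₀,b` — and returns `g` in the group (4) with `W^g` in the same regular fibre and `‖(W^g)_bU₀,b⁻¹ − 1‖ ≤ 1600·L^{−(K−n)}·D(b) + 4096·ρ(b)` on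
EVERY bond `b = ⟨z, μ⟩`.  Both the sup bound (take `sup D`, `sup ρ`) and an `ℓ²` bound (square and sum) of the blended representative are thereby reduced
to estimates on the corner data alone (CARD-19200-V3-g9 §7 (s), (a)–(c)).

WHAT IS PROVED (sorry-free, no definition; `L ≥ 7`; `D ≤ 1/1600`, `ρ ≤ 1/4096` pointwise).  `norm_vec01`; **`exists_blendedGauge_of_corners_T3`**.

HONEST SCOPE.  A kernel theorem about the carrier's lattice objects (no statement of [Balaban1985Variational] is proved); count-neutral helper toward
stmt-QuantumFields-19200 (`--supports`).  It does not supply corner data: with gen 7's comb elements (`Prop7BlendSite.corner_family_T3`) it re-proves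
`exists_blendedGauge_T3`; the local-Coulomb corner data (flat interior gradient estimate + Hodge gap + global (4)-Poincaré, CARD §7) are open.

References: T. Bałaban, CMP 102 (1985) 277–309 [Balaban1985Variational] ((4) p.278, (18) p.280, Prop. 7 p.299); CMP 99 (1985) 75–102
[Balaban1985RegularSpaces] (Lemma 1 p.79, p.80); CMP 98 (1985) 17–51 [Balaban1985Averaging] ((8) p.18).
-/

noncomputable section

open NormedSpace
open scoped Matrix.Norms.L2Operator

namespace Summit.QuantumFields.YangMills.Theorems.Prop7BlendReduction

open Literature.MathematicalPhysics.QuantumFieldTheory.Balaban1983to89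
open T4Continuum BlockAveraging
open B10Eq27TorusAxialLog (rel transl transl_apply transl_zero)
open B7Prop1Explicit renaming Site → LSite
open B5Eq118OneStroke (iterBlockOf)
open B15DeterminingSets (embIter)
open MatrixLog (mlog)
open Literature.MathematicalPhysics.QuantumFieldTheory.Balaban1983to89.T3ContinuumYM3Torus
open Literature.MathematicalPhysics.QuantumFieldTheory.Balaban1983to89.T3PrintedRegularMinimiser (RegPr regFibrePr mem_regFibrePr_iff)
open Literature.MathematicalPhysics.QuantumFieldTheory.Balaban1983to89.T3PrintedRegularOrbits (descTransf gaugeAct_mem_regFibrePr_iff_of_trivial)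
open Literature.MathematicalPhysics.QuantumFieldTheory.Balaban1983to89.T3SectALandauChart (pos_of_regPr)
open BlockAveragingEMLLinearisedBackground (pertVar)
open Summit.QuantumFields.YangMills.Theorems.Prop7FlatHolonomy (transfUp_eq_embIter)
open Summit.QuantumFields.YangMills.Theorems.Prop7GeodesicBlend
open Summit.QuantumFields.YangMills.Theorems.Prop7BlendBond
open Summit.QuantumFields.YangMills.Theorems.Prop7BlendCells
open Summit.QuantumFields.YangMills.Theorems.Prop7BlendSite (dist1_transport_eq vec_mem01)
open Summit.QuantumFields.YangMills.Theorems.Prop7BlendedGauge (three_le_sitesPerDir)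

section T3

variable (F : T3Family) {n K : ℕ} (h : n ≤ K)

/-- **THE BLEND REDUCTION.**  `L ≥ 7`; `W ∈ 𝔘_k(ε₀) ∩ 𝔅_k(V)`; `off` a uniform centre offset (`Prop7AxialGaugeFace.exists_off_embIter`); `vE x y ∈ SU(2)`
any corner gauges with `vE y y = 1` at every centre `y`.  Suppose that on the cell `c(z)` of every site `z` (corners `c(z) + ε`, `ε ∈ {0,1}³`) and for
every direction `μ`: the eight values `vE z (c(z)+ε)` are pairwise `D(z,μ)`-close, so are the eight values `vE (z+e_μ) (c(z)+ε)`, `D(z,μ) ≤ 1/1600`, and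
`‖vE z (c(z)+ε)·W_b·vE (z+e_μ) (c(z)+ε)*·U₀,b* − 1‖ ≤ ρ(z,μ) ≤ 1/4096`.  Then the trilinear geodesic blend `g` of the corner gauges lies in print's group
(4) (`g↓ = 1`), `W^g ∈ 𝔘_k(ε₀) ∩ 𝔅_k(V)`, and `‖(W^g)_b·U₀,b⁻¹ − 1‖ ≤ 1600·L^{−(K−n)}·D(z,μ) + 4096·ρ(z,μ)` for EVERY bond `b = ⟨z, μ⟩`.
[cite: Balaban1985Variational, (4) p.278, (18) p.280; Balaban1985RegularSpaces, Lemma 1 p.79] -/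
theorem exists_blendedGauge_of_corners_T3 (hL : 7 ≤ F.L) {ε₀ : ℝ}
    {V : GaugeField (F.P n) 0 (Matrix.specialUnitaryGroup (Fin 2) ℂ)} (U₀ W : GaugeField (F.P K) 0 (Matrix.specialUnitaryGroup (Fin 2) ℂ))
    (hW : W ∈ regFibrePr F n K h ε₀ V) {off : ℕ}
    (hoff : ∀ (y : Site (F.P K) (K - n)) (μ : Fin (F.P K).d), ((embIter (K - n) y) μ).val = (y μ).val * (F.P K).L ^ (K - n) + off)
    (vE : Site (F.P K) 0 → Site (F.P K) (K - n) → Matrix (Fin 2) (Fin 2) ℂ)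
    (hSU : ∀ x y, vE x y ∈ Matrix.specialUnitaryGroup (Fin 2) ℂ) (h0 : ∀ y, vE (embIter (K - n) y) y = 1)
    (D ρ : Site (F.P K) 0 → Fin (F.P K).d → ℝ) (hD : ∀ z μ, D z μ ≤ 1 / 1600) (hρ : ∀ z μ, ρ z μ ≤ 1 / 4096)
    (hvv : ∀ (z : Site (F.P K) 0) (μ : Fin (F.P K).d) (ε ε' : LSite (F.P K).d), (∀ ν, ε ν = 0 ∨ ε ν = 1) → (∀ ν, ε' ν = 0 ∨ ε' ν = 1) →
      ‖vE z (transl (iterBlockOf (K - n) (transl z (fun _ => -(off : ℤ)))) ε) *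
          star (vE z (transl (iterBlockOf (K - n) (transl z (fun _ => -(off : ℤ)))) ε')) - 1‖ ≤ D z μ ∧
      ‖vE (z.shift μ) (transl (iterBlockOf (K - n) (transl z (fun _ => -(off : ℤ)))) ε) *
          star (vE (z.shift μ) (transl (iterBlockOf (K - n) (transl z (fun _ => -(off : ℤ)))) ε')) - 1‖ ≤ D z μ)
    (htr : ∀ (z : Site (F.P K) 0) (μ : Fin (F.P K).d) (ε : LSite (F.P K).d), (∀ ν, ε ν = 0 ∨ ε ν = 1) →
      ‖vE z (transl (iterBlockOf (K - n) (transl z (fun _ => -(off : ℤ)))) ε) *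
          ((W ⟨z, μ⟩ : Matrix.specialUnitaryGroup (Fin 2) ℂ) : Matrix (Fin 2) (Fin 2) ℂ) *
          star (vE (z.shift μ) (transl (iterBlockOf (K - n) (transl z (fun _ => -(off : ℤ)))) ε)) *
          star ((U₀ ⟨z, μ⟩ : Matrix.specialUnitaryGroup (Fin 2) ℂ) : Matrix (Fin 2) (Fin 2) ℂ) - 1‖ ≤ ρ z μ) :
    ∃ g : GaugeTransf (F.P K) 0 (Matrix.specialUnitaryGroup (Fin 2) ℂ),
      descTransf F n K h g = (fun _ => 1) ∧
      GaugeField.gaugeAct g W ∈ regFibrePr F n K h ε₀ V ∧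
      ∀ (z : Site (F.P K) 0) (μ : Fin (F.P K).d),
        ‖pertVar U₀ (GaugeField.gaugeAct g W) ⟨z, μ⟩‖ ≤ 1600 * (((F.L : ℝ))⁻¹) ^ (K - n) * D z μ + 4096 * ρ z μ := by
  -- unpack
  have hWr : RegPr F n K ε₀ W := ((mem_regFibrePr_iff F).mp hW).2
  have hε₀ : 0 < ε₀ := pos_of_regPr F hWr
  have hk : K - n ≤ (F.P K).m + (F.P K).K := by show K - n ≤ F.m + K; omega
  have hN : 3 ≤ (F.P K).sitesPerDir (K - n) := three_le_sitesPerDir F (n := n) (K := K) hL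
  have hd : (F.P K).d = 3 := T3Family.P_d F K
  have hLL : (F.P K).L = F.L := rfl
  have hL0 : (0 : ℝ) < (F.L : ℝ) := by exact_mod_cast (show 0 < F.L by omega)
  have hpow : 0 < F.L ^ (K - n) := pow_pos (by omega) _
  -- the three coordinates
  let κ0 : Fin (F.P K).d := ⟨0, by rw [hd]; norm_num⟩
  let κ1 : Fin (F.P K).d := ⟨1, by rw [hd]; norm_num⟩
  let κ2 : Fin (F.P K).d := ⟨2, by rw [hd]; norm_num⟩
  have h01 : κ0 ≠ κ1 := by intro h'; have := congrArg Fin.val h'; simp [κ0, κ1] at this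
  have h02 : κ0 ≠ κ2 := by intro h'; have := congrArg Fin.val h'; simp [κ0, κ2] at this
  have h12 : κ1 ≠ κ2 := by intro h'; have := congrArg Fin.val h'; simp [κ1, κ2] at this
  have hκ : ∀ ν : Fin (F.P K).d, ν = κ0 ∨ ν = κ1 ∨ ν = κ2 := by
    intro ν
    have hν : ν.val < 3 := ν.isLt
    have : ν.val = 0 ∨ ν.val = 1 ∨ ν.val = 2 := by omega
    rcases this with h' | h' | h'
    · left; exact Fin.ext h'
    · right; left; exact Fin.ext h'
    · right; right; exact Fin.ext h'
  -- the data of the blend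
  let cz : Site (F.P K) 0 → Site (F.P K) (K - n) := fun z => iterBlockOf (K - n) (transl z (fun _ => -(off : ℤ)))
  let rz : Site (F.P K) 0 → Fin (F.P K).d → ℕ := fun z ν => ((transl z (fun _ => -(off : ℤ))) ν).val % F.L ^ (K - n)
  let vec : Fin 2 → Fin 2 → Fin 2 → LSite (F.P K).d :=
    fun i j k ν => if ν = κ0 then ((i : ℕ) : ℤ) else if ν = κ1 then ((j : ℕ) : ℤ) else ((k : ℕ) : ℤ)
  let fam : Site (F.P K) (K - n) → Site (F.P K) 0 → Fin 2 → Fin 2 → Fin 2 → Matrix (Fin 2) (Fin 2) ℂ :=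
    fun c' x i j k => vE x (transl c' (vec i j k))
  let G : ℝ → Matrix (Fin 2) (Fin 2) ℂ → Matrix (Fin 2) (Fin 2) ℂ → Matrix (Fin 2) (Fin 2) ℂ :=
    fun t a b => exp (((t : ℂ)) • mlog (b * star a)) * a
  let Bl : (Fin 2 → Fin 2 → Fin 2 → Matrix (Fin 2) (Fin 2) ℂ) → ℝ → ℝ → ℝ → Matrix (Fin 2) (Fin 2) ℂ :=
    fun u t₀ t₁ t₂ => G t₂ (G t₁ (G t₀ (u 0 0 0) (u 1 0 0)) (G t₀ (u 0 1 0) (u 1 1 0))) (G t₁ (G t₀ (u 0 0 1) (u 1 0 1)) (G t₀ (u 0 1 1) (u 1 1 1)))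
  let hh : ℝ := (F.L : ℝ) ^ (K - n)
  let gM : Site (F.P K) 0 → Matrix (Fin 2) (Fin 2) ℂ := fun z => Bl (fam (cz z) z) (rz z κ0 / hh) (rz z κ1 / hh) (rz z κ2 / hh)
  have hhpos : 0 < hh := pow_pos hL0 _
  have hvec : ∀ i j k ν, vec i j k ν = 0 ∨ vec i j k ν = 1 := fun i j k ν => vec_mem01 κ0 κ1 i j k ν
  -- the corner data at every site, in coordinates
  have hfam : ∀ (z : Site (F.P K) 0) (μ : Fin (F.P K).d),
      (∀ i j k, fam (cz z) z i j k ∈ Matrix.specialUnitaryGroup (Fin 2) ℂ) ∧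
      (∀ i j k, fam (cz z) (z.shift μ) i j k ∈ Matrix.specialUnitaryGroup (Fin 2) ℂ) ∧
      (∀ i j k i' j' k', ‖fam (cz z) z i j k * star (fam (cz z) z i' j' k') - 1‖ ≤ D z μ) ∧
      (∀ i j k i' j' k', ‖fam (cz z) (z.shift μ) i j k * star (fam (cz z) (z.shift μ) i' j' k') - 1‖ ≤ D z μ) ∧
      (∀ i j k, ‖fam (cz z) z i j k * ((W ⟨z, μ⟩ : Matrix.specialUnitaryGroup (Fin 2) ℂ) : Matrix (Fin 2) (Fin 2) ℂ) *
          star (fam (cz z) (z.shift μ) i j k) * star ((U₀ ⟨z, μ⟩ : Matrix.specialUnitaryGroup (Fin 2) ℂ) : Matrix (Fin 2) (Fin 2) ℂ) - 1‖ ≤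
        ρ z μ) ∧
      (∀ κ, rz z κ < F.L ^ (K - n)) := by
    intro z μ
    refine ⟨fun i j k => hSU _ _, fun i j k => hSU _ _, fun i j k i' j' k' => (hvv z μ _ _ (hvec i j k) (hvec i' j' k')).1,
      fun i j k i' j' k' => (hvv z μ _ _ (hvec i j k) (hvec i' j' k')).2, fun i j k => htr z μ _ (hvec i j k), fun κ => Nat.mod_lt _ hpow⟩
  have hD0 : ∀ z μ, 0 ≤ D z μ := by
    intro z μ
    have h1 := (hfam z μ).2.2.1 0 0 0 0 0 0
    exact (norm_nonneg _).trans h1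
  have hw01 : ∀ (z : Site (F.P K) 0) (κ : Fin (F.P K).d), 0 ≤ (rz z κ : ℝ) / hh ∧ (rz z κ : ℝ) / hh ≤ 1 := by
    intro z κ
    refine ⟨by positivity, ?_⟩
    rw [div_le_one hhpos]
    show ((rz z κ : ℕ) : ℝ) ≤ (F.L : ℝ) ^ (K - n)
    exact_mod_cast ((hfam z κ0).2.2.2.2.2 κ).le
  -- SU-membership of the blend
  have hmem : ∀ z, gM z ∈ Matrix.specialUnitaryGroup (Fin 2) ℂ := by
    intro z
    obtain ⟨hvSU, -, hvv', -, -, -⟩ := hfam z κ0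
    have hD507 : D z κ0 ≤ 1 / 507 := (hD z κ0).trans (by norm_num)
    have hDπ : (Fintype.card (Fin 2) : ℝ) * (169 * D z κ0) < Real.pi := by
      rw [Fintype.card_fin]; push_cast
      have := Real.pi_gt_three; have := hD z κ0; nlinarith
    exact blend_mem_specialUnitaryGroup G arc_hmem arc_hmemSU arc_hnear (fam (cz z) z) hvSU hD507 hDπ hvv' (rz z κ2 / hh)
      (hw01 z κ0).1 (hw01 z κ0).2 (hw01 z κ1).1 (hw01 z κ1).2
  -- THE GAUGE TRANSFORMATION
  let g : GaugeTransf (F.P K) 0 (Matrix.specialUnitaryGroup (Fin 2) ℂ) := fun z => ⟨gM z, hmem z⟩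
  -- (4): `g = 1` at the centres
  have hcentre : ∀ c₀ : Site (F.P K) (K - n), g (embIter (K - n) c₀) = 1 := by
    intro c₀
    apply Subtype.ext
    show gM (embIter (K - n) c₀) = 1
    obtain ⟨hc, hr⟩ := cell_centre hk hoff c₀
    have hr' : ∀ κ, (rz (embIter (K - n) c₀) κ : ℝ) / hh = 0 := by
      intro κ; have : rz (embIter (K - n) c₀) κ = 0 := hr κ
      rw [this, Nat.cast_zero, zero_div]
    show Bl (fam (cz (embIter (K - n) c₀)) (embIter (K - n) c₀)) (rz (embIter (K - n) c₀) κ0 / hh) (rz (embIter (K - n) c₀) κ1 / hh)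
      (rz (embIter (K - n) c₀) κ2 / hh) = 1
    rw [hr' κ0, hr' κ1, hr' κ2]
    show G 0 (G 0 (G 0 _ _) (G 0 _ _)) (G 0 (G 0 _ _) (G 0 _ _)) = 1
    rw [blend_corner G arc_h0]
    have hcz : cz (embIter (K - n) c₀) = c₀ := hc
    have hvec0 : vec 0 0 0 = 0 := by funext ν; simp [vec]
    show vE (embIter (K - n) c₀) (transl (cz (embIter (K - n) c₀)) (vec 0 0 0)) = 1
    rw [hcz, hvec0, transl_zero]
    exact h0 c₀
  have h4 : descTransf F n K h g = fun _ => 1 := by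
    funext x; unfold descTransf; rw [transfUp_eq_embIter]; exact hcentre _
  refine ⟨g, h4, (gaugeAct_mem_regFibrePr_iff_of_trivial F h hε₀.le h4 W V).mpr hW, ?_⟩
  -- THE BOUND ON EVERY BOND
  intro z μ
  show dist1 (g z * W ⟨z, μ⟩ * (g (z.shift μ))⁻¹ * (U₀ ⟨z, μ⟩)⁻¹) ≤ _
  rw [dist1_transport_eq]
  show ‖gM z * ((W ⟨z, μ⟩ : Matrix.specialUnitaryGroup (Fin 2) ℂ) : Matrix (Fin 2) (Fin 2) ℂ) * star (gM (z.shift μ)) *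
      star ((U₀ ⟨z, μ⟩ : Matrix.specialUnitaryGroup (Fin 2) ℂ) : Matrix (Fin 2) (Fin 2) ℂ) - 1‖ ≤ _
  obtain ⟨hvSU, hwSU, hvv', hww', htr', hrlt⟩ := hfam z μ
  have hvU : ∀ i j k, fam (cz z) z i j k ∈ Matrix.unitaryGroup (Fin 2) ℂ := fun i j k =>
    (Matrix.mem_specialUnitaryGroup_iff.1 (hvSU i j k)).1
  have hwU : ∀ i j k, fam (cz z) (z.shift μ) i j k ∈ Matrix.unitaryGroup (Fin 2) ℂ := fun i j k =>
    (Matrix.mem_specialUnitaryGroup_iff.1 (hwSU i j k)).1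
  -- the weights of `z + e_μ` from the cell of `z`
  let r' : Fin (F.P K).d → ℕ := fun ν => rz z ν + if ν = μ then 1 else 0
  have hr'le : ∀ κ, r' κ ≤ F.L ^ (K - n) := by
    intro κ; have h1 : rz z κ < F.L ^ (K - n) := hrlt κ; show rz z κ + (if κ = μ then 1 else 0) ≤ _; split_ifs <;> omega
  have hs01 : ∀ κ, 0 ≤ (r' κ : ℝ) / hh ∧ (r' κ : ℝ) / hh ≤ 1 := fun κ =>
    ⟨by positivity, by rw [div_le_one hhpos]; show ((r' κ : ℕ) : ℝ) ≤ (F.L : ℝ) ^ (K - n); exact_mod_cast hr'le κ⟩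
  have hdiff : ∀ κ, |(rz z κ : ℝ) / hh - (r' κ : ℝ) / hh| = (if κ = μ then 1 else 0) / hh := by
    intro κ
    by_cases hκμ : κ = μ
    · simp only [r', if_pos hκμ]; push_cast
      rw [show ((rz z κ : ℕ) : ℝ) / hh - (((rz z κ : ℕ) : ℝ) + 1) / hh = -(1 / hh) by ring, abs_neg, abs_of_pos (by positivity)]
    · simp only [r', if_neg hκμ, add_zero, sub_self, abs_zero, zero_div]
  have hind : (if κ0 = μ then (1 : ℝ) else 0) + (if κ1 = μ then (1 : ℝ) else 0) + (if κ2 = μ then (1 : ℝ) else 0) ≤ 1 := by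
    by_cases h0' : κ0 = μ
    · have h1 : ¬ κ1 = μ := fun h1 => h01 (h0'.trans h1.symm)
      have h2 : ¬ κ2 = μ := fun h2 => h02 (h0'.trans h2.symm)
      rw [if_pos h0', if_neg h1, if_neg h2]; norm_num
    · by_cases h1 : κ1 = μ
      · have h2 : ¬ κ2 = μ := fun h2 => h12 (h1.trans h2.symm)
        rw [if_neg h0', if_pos h1, if_neg h2]; norm_num
      · rw [if_neg h0', if_neg h1]; split_ifs <;> norm_num
  have hsumdiff : |(rz z κ0 : ℝ) / hh - (r' κ0 : ℝ) / hh| + |(rz z κ1 : ℝ) / hh - (r' κ1 : ℝ) / hh| + |(rz z κ2 : ℝ) / hh - (r' κ2 : ℝ) / hh| ≤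
      1 / hh := by
    rw [hdiff κ0, hdiff κ1, hdiff κ2, ← add_div, ← add_div]
    exact div_le_div_of_nonneg_right hind hhpos.le
  -- the group-side bond estimate with the OLD corners at the NEW weights
  have hbond : ‖gM z * ((W ⟨z, μ⟩ : Matrix.specialUnitaryGroup (Fin 2) ℂ) : Matrix (Fin 2) (Fin 2) ℂ) *
      star (Bl (fam (cz z) (z.shift μ)) (r' κ0 / hh) (r' κ1 / hh) (r' κ2 / hh)) *
      star ((U₀ ⟨z, μ⟩ : Matrix.specialUnitaryGroup (Fin 2) ℂ) : Matrix (Fin 2) (Fin 2) ℂ) - 1‖ ≤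
      1600 * (((F.L : ℝ))⁻¹) ^ (K - n) * D z μ + 4096 * ρ z μ := by
    have hmain := blend_bond_le (fam (cz z) z) (fam (cz z) (z.shift μ)) hvU hwU (hD z μ) hvv' hww'
      (Matrix.mem_specialUnitaryGroup_iff.1 (Subtype.coe_prop (W ⟨z, μ⟩))).1
      (Matrix.mem_specialUnitaryGroup_iff.1 (Subtype.coe_prop (U₀ ⟨z, μ⟩))).1 (hρ z μ) htr'
      (hw01 z κ0).1 (hw01 z κ0).2 (hw01 z κ1).1 (hw01 z κ1).2 (hw01 z κ2).1 (hw01 z κ2).2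
      (hs01 κ0).1 (hs01 κ0).2 (hs01 κ1).1 (hs01 κ1).2 (hs01 κ2).1 (hs01 κ2).2
    refine hmain.trans ?_
    have hinv : 1 / hh = (((F.L : ℝ))⁻¹) ^ (K - n) := by show 1 / (F.L : ℝ) ^ (K - n) = _; rw [one_div, ← inv_pow]
    have hDz := hD0 z μ
    calc 1600 * (|(rz z κ0 : ℝ) / hh - (r' κ0 : ℝ) / hh| + |(rz z κ1 : ℝ) / hh - (r' κ1 : ℝ) / hh| +
          |(rz z κ2 : ℝ) / hh - (r' κ2 : ℝ) / hh|) * D z μ + 4096 * ρ z μ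
        ≤ 1600 * (1 / hh) * D z μ + 4096 * ρ z μ := by gcongr
      _ = 1600 * (((F.L : ℝ))⁻¹) ^ (K - n) * D z μ + 4096 * ρ z μ := by rw [hinv]
  -- it remains to identify `gM (z + e_μ)` with the blend of the OLD corners at the NEW weights
  suffices hid : gM (z.shift μ) = Bl (fam (cz z) (z.shift μ)) (r' κ0 / hh) (r' κ1 / hh) (r' κ2 / hh) by
    rw [hid]; exact hbond
  have hrμ : rz z μ < F.L ^ (K - n) := hrlt μ
  have hD507 : D z μ ≤ 1 / 507 := (hD z μ).trans (by norm_num)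
  rcases Nat.lt_or_ge (rz z μ) (F.L ^ (K - n) - 1) with hint | hge
  · -- INTERIOR STEP: same cell, `r_μ ↦ r_μ + 1`
    obtain ⟨hc, hrμ', hrν⟩ := cell_shift_of_lt (P := F.P K) hk (off := off) z μ (by rw [hLL]; exact hint)
    have hr' : ∀ κ, rz (z.shift μ) κ = r' κ := by
      intro κ
      by_cases hκμ : κ = μ
      · subst hκμ; show _ = rz z κ + if κ = κ then 1 else 0; rw [if_pos rfl]
        have := hrμ'; rw [hLL] at this; exact this
      · show _ = rz z κ + if κ = μ then 1 else 0; rw [if_neg hκμ, add_zero]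
        have := hrν κ hκμ; rw [hLL] at this; exact this
    show Bl (fam (cz (z.shift μ)) (z.shift μ)) (rz (z.shift μ) κ0 / hh) (rz (z.shift μ) κ1 / hh) (rz (z.shift μ) κ2 / hh) = _
    have hcz : cz (z.shift μ) = cz z := hc
    rw [hcz, hr' κ0, hr' κ1, hr' κ2]
  · -- FACE STEP: the shifted cell, `r_μ ↦ 0`; the blend is single-valued across the cells of centres
    have hface : rz z μ = F.L ^ (K - n) - 1 := by omega
    obtain ⟨hc, hrμ', hrν⟩ := cell_shift_of_eq (P := F.P K) hk (off := off) z μ (by rw [hLL]; exact hface)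
    have hcz : cz (z.shift μ) = (cz z).shift μ := hc
    have hr0 : (rz (z.shift μ) μ : ℝ) / hh = 0 := by
      have : rz (z.shift μ) μ = 0 := by have := hrμ'; rw [hLL] at this; exact this
      rw [this, Nat.cast_zero, zero_div]
    have hrsame : ∀ κ, κ ≠ μ → rz (z.shift μ) κ = rz z κ := by
      intro κ hκμ; have := hrν κ hκμ; rw [hLL] at this; exact this
    have hr'μ : (r' μ : ℝ) / hh = 1 := by
      show ((rz z μ + if μ = μ then 1 else 0 : ℕ) : ℝ) / hh = 1
      rw [if_pos rfl, hface, Nat.sub_add_cancel (Nat.one_le_pow _ _ (by omega)), Nat.cast_pow, div_self hhpos.ne']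
    have hr'same : ∀ κ, κ ≠ μ → r' κ = rz z κ := by
      intro κ hκμ; show rz z κ + (if κ = μ then 1 else 0) = rz z κ; rw [if_neg hκμ, add_zero]
    -- the shifted cell's corners: `(c + e_μ) + ε = c + (ε + e_μ)`
    have hshift : ∀ ε : LSite (F.P K).d, transl ((cz z).shift μ) ε = transl (cz z) (Function.update ε μ (ε μ + 1)) := by
      intro ε; funext ν
      simp only [transl_apply, Site.shift]
      by_cases hν : ν = μ
      · subst hν; simp only [Function.update_self]; push_cast; ring
      · simp only [Function.update_of_ne hν]
    -- level data of the old family `w` at `z + e_μ` (weights of the two untouched coordinates)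
    obtain ⟨hA, hAA, hB, hBB, -⟩ := blend_mem_unitaryGroup G arc_hmem arc_hnear (fam (cz z) (z.shift μ)) hwU hD507 hww' (rz z κ1 / hh)
      (hw01 z κ0).1 (hw01 z κ0).2 (hw01 z κ1).1 (hw01 z κ1).2
    have hD1 : D z μ < 1 := by linarith [hD z μ]
    have h13D1 : 13 * D z μ < 1 := by linarith [hD z μ]
    have h169D1 : 169 * D z μ < 1 := by linarith [hD z μ]
    -- the corner vectors of the shifted cell
    have hval0 : ((((0 : Fin 2) : ℕ) : ℤ)) = 0 := by simp
    have hval1 : ((((1 : Fin 2) : ℕ) : ℤ)) = 1 := by simp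
    have hv0 : ∀ j k, Function.update (vec 0 j k) κ0 (vec 0 j k κ0 + 1) = vec 1 j k := by
      intro j k; funext ν
      by_cases hν : ν = κ0
      · subst hν; simp only [Function.update_self, vec, if_pos rfl, hval0, hval1]; ring
      · rw [Function.update_of_ne hν]; simp only [vec, if_neg hν]
    have hv1 : ∀ i k, Function.update (vec i 0 k) κ1 (vec i 0 k κ1 + 1) = vec i 1 k := by
      intro i k; funext ν
      by_cases hν : ν = κ1
      · subst hν; simp [vec]
        split_ifs with hc
        · exact absurd hc (Ne.symm h01)
        · norm_num
      · rw [Function.update_of_ne hν]; simp only [vec, if_neg hν]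
    have hv2 : ∀ i j, Function.update (vec i j 0) κ2 (vec i j 0 κ2 + 1) = vec i j 1 := by
      intro i j; funext ν
      by_cases hν : ν = κ2
      · subst hν; simp [vec]
        split_ifs with hc hc'
        · exact absurd hc (Ne.symm h02)
        · exact absurd hc' (Ne.symm h12)
        · norm_num
      · rw [Function.update_of_ne hν]
        rcases hκ ν with h' | h' | h'
        · simp [vec, h']
        · simp [vec, h']
        · exact absurd h' hν
    show Bl (fam (cz (z.shift μ)) (z.shift μ)) (rz (z.shift μ) κ0 / hh) (rz (z.shift μ) κ1 / hh) (rz (z.shift μ) κ2 / hh) = _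
    rw [hcz]
    rcases hκ μ with hμ | hμ | hμ
    · -- crossing in the first coordinate
      subst hμ
      have hw' : ∀ j k, fam ((cz z).shift κ0) (z.shift κ0) 0 j k = fam (cz z) (z.shift κ0) 1 j k := by
        intro j k; show vE _ (transl ((cz z).shift κ0) (vec 0 j k)) = vE _ (transl (cz z) (vec 1 j k)); rw [hshift, hv0]
      rw [hr0, show rz (z.shift κ0) κ1 = r' κ1 by rw [hrsame κ1 (Ne.symm h01), hr'same κ1 (Ne.symm h01)],
        show rz (z.shift κ0) κ2 = r' κ2 by rw [hrsame κ2 (Ne.symm h02), hr'same κ2 (Ne.symm h02)], hr'μ]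
      show G _ (G _ (G 0 _ _) (G 0 _ _)) (G _ (G 0 _ _) (G 0 _ _)) = G _ (G _ (G 1 _ _) (G 1 _ _)) (G _ (G 1 _ _) (G 1 _ _))
      rw [blend_face₁₀ G arc_h0 (fam ((cz z).shift κ0) (z.shift κ0)), hw', hw', hw', hw',
        blend_face₁₁ G arc_h1 (fam (cz z) (z.shift κ0)) hwU (fun j k => (hww' 1 j k 0 j k).trans_lt hD1)]
    · -- crossing in the second coordinate
      subst hμ
      have hw' : ∀ i k, fam ((cz z).shift κ1) (z.shift κ1) i 0 k = fam (cz z) (z.shift κ1) i 1 k := by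
        intro i k; show vE _ (transl ((cz z).shift κ1) (vec i 0 k)) = vE _ (transl (cz z) (vec i 1 k)); rw [hshift, hv1]
      rw [hr0, show rz (z.shift κ1) κ0 = r' κ0 by rw [hrsame κ0 h01, hr'same κ0 h01],
        show rz (z.shift κ1) κ2 = r' κ2 by rw [hrsame κ2 (Ne.symm h12), hr'same κ2 (Ne.symm h12)], hr'μ, hr'same κ0 h01]
      show G _ (G 0 (G _ _ _) (G _ _ _)) (G 0 (G _ _ _) (G _ _ _)) = G _ (G 1 (G _ _ _) (G _ _ _)) (G 1 (G _ _ _) (G _ _ _))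
      rw [blend_face₂₀ G arc_h0 (fam ((cz z).shift κ1) (z.shift κ1)), hw', hw', hw', hw',
        blend_face₂₁ G arc_h1 (fam (cz z) (z.shift κ1)) (fun k => hA 0 k) (fun k => (hAA 1 k 0 k).trans_lt h13D1)]
    · -- crossing in the third coordinate
      subst hμ
      have hw' : ∀ i j, fam ((cz z).shift κ2) (z.shift κ2) i j 0 = fam (cz z) (z.shift κ2) i j 1 := by
        intro i j; show vE _ (transl ((cz z).shift κ2) (vec i j 0)) = vE _ (transl (cz z) (vec i j 1)); rw [hshift, hv2]
      rw [hr0, show rz (z.shift κ2) κ0 = r' κ0 by rw [hrsame κ0 h02, hr'same κ0 h02],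
        show rz (z.shift κ2) κ1 = r' κ1 by rw [hrsame κ1 h12, hr'same κ1 h12], hr'μ, hr'same κ0 h02, hr'same κ1 h12]
      show G 0 (G _ (G _ _ _) (G _ _ _)) (G _ (G _ _ _) (G _ _ _)) = G 1 (G _ (G _ _ _) (G _ _ _)) (G _ (G _ _ _) (G _ _ _))
      rw [blend_face₃₀ G arc_h0 (fam ((cz z).shift κ2) (z.shift κ2)), hw', hw', hw', hw',
        blend_face₃₁ G arc_h1 (fam (cz z) (z.shift κ2)) (hB 0) (by rw [udist_symm]; exact hBB.trans_lt h169D1)]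

end T3

end Summit.QuantumFields.YangMills.Theorems.Prop7BlendReduction

end
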